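import Mathlib
import Literature.Analysis.FluidPDE.SelfSimilarEulerProfileVorticity
import Literature.Analysis.ODE.LinearConeDichotomy
import HarnessLib.Audit

/-!
# Rung C1 of the crux `EulerZoomLiouville.PowerGaugeEulerLiouville`: vorticity along backward
# self-similar trajectories — the quantitative Cauchy formula and the KILL step at a stagnation point

Route №10 `EulerZoomLiouville` (NavierStokesRegularity), crux E = stmt-NavierStokesRegularity-19832,
tenure rung C1 (exactly self-similar members), registered residue `stub_selfSimilarExtremal`.
PROFILE-LEVEL toolkit, first file of the NODAL-FINITENESS chain (lineage ns-typeII-p2, gen 6): for a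
`C²` stationary self-similar Euler profile `(U, P)` (`IsSelfSimilarEulerProfile γ c U P`, CIV 2026
(3.3)) with transport field `V = γ(y − c) + U` and vorticity `Ω = curl U`:

* `hasDerivAt_curl_comp` — along any solution of `Y' = σ V(Y)`,
  `d/dt Ω(Y) = σ (DV(Y) Ω(Y) − (1+γ) Ω(Y))` (the commutator identity `[V, Ω] = −(1+γ)Ω`, tree
  `IsSelfSimilarEulerVorticityProfile.fderiv_curl_transport_sub_fderiv_transport_curl`, composed with
  the chain rule);
* `hasDerivAt_weightedCurl_comp` — **the quantitative Cauchy formula without flow derivatives**: the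
  weighted vorticity `u(t) = e^{σ(1+γ)t} Ω(Y(t))` solves the LINEAR variational equation
  `u' = σ DV(Y(t)) u` (CIV (3.22) says `Ω(Y) = e^{−(1+γ)τ} ∇_aY · Ω(a)`; here only the ODE it encodes);
* `curl_comp_eq_zero_of_tendsto_of_lowerCertificate` — **THE KILL STEP.** Let `Y` be a BACKWARD
  trajectory (`Y' = −V(Y)`) converging to a point `z` (necessarily a stagnation point), let the vorticity
  be bounded (`‖Ω‖ ≤ m`) and the velocity gradient bounded (`‖DU‖ ≤ K`).  If `z` carries a LOWER
  GROWTH CERTIFICATE below the Cauchy rate — a coercive bilinear form `B` and `β' < 1 + γ` with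
  `B(DV(z)v, v) + B(v, DV(z)v) ≤ 2β' B(v, v)` for all `v` (this holds iff every eigenvalue of `DV(z)`
  has real part `< 1 + γ`, i.e. every eigenvalue of `DU(z)` has real part `< 1`) — then `Ω(Y(0)) = 0`:
  the weighted vorticity decays like `e^{−(1+γ)t}` but the certificate forbids decay faster than
  `e^{−(β'+o(1))t}` (`Literature.Analysis.ODE.eq_zero_of_norm_le_exp_of_lower_certificate`), so it
  vanishes from some time on, hence at time `0` by uniqueness for the linear equation.

Reading: **vorticity can only emanate (backward in self-similar time) from stagnation points `z` at
which `DU(z)` has an eigenvalue of real part `≥ 1`** — the spectral sharpening of the lineage's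
stretching criterion `⟪DU(z)w, w⟫ ≥ |w|²` (`SelfSimilarEulerStagnationStretching`), now trajectory-wise.

WHAT THIS IS NOT: not NS, not E, not rung C1 — Lagrangian bookkeeping for classical profiles; no
far-field hypothesis is used in this file.

## References

* P. Constantin, M. Ignatova, V. Vicol, arXiv:2602.17570 (2026), §3.1.1 (3.4), §3.4.1 (3.21)–(3.22)
  (self-similar Cauchy formula), proof of Thm 3.10. [ConstantinIgnatovaVicol2026Putative]
* P. Hartman, *Ordinary Differential Equations*, SIAM 2002, Ch. IV (one-sided Grönwall). [Hartman2002]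
-/

noncomputable section

-- flat `Theorems/<Route><Decl>…` files of one crux share the namespace of the crux (tree convention)
set_option linter.dupNamespace false

open Set Filter Topology Metric Function InnerProductSpace
open scoped RealInnerProductSpace NNReal

namespace Summit.NavierStokesRegularity.NavierStokesRegularity.Theorems.PowerGaugeEulerLiouville.NodalFiniteness

open Literature.Analysis Literature.Analysis.FluidPDE Literature.Analysis.ODE

variable {γ : ℝ} {c : (EuclideanSpace ℝ (Fin 3))} {U : (EuclideanSpace ℝ (Fin 3)) → (EuclideanSpace ℝ (Fin 3))} {P : (EuclideanSpace ℝ (Fin 3)) → ℝ}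

/-! ### The transport field and its gradient -/

/-- `DV(y) = γ I + DU(y)`. [cite: ConstantinIgnatovaVicol2026Putative, §3.4 eq. (3.19)] -/
theorem fderiv_transport_eq (h : IsSelfSimilarEulerProfile γ c U P) (y : (EuclideanSpace ℝ (Fin 3))) :
    fderiv ℝ (selfSimilarTransport γ c U) y =
      γ • ContinuousLinearMap.id ℝ (EuclideanSpace ℝ (Fin 3)) + fderiv ℝ U y :=
  (hasFDerivAt_selfSimilarTransport h.differentiable_velocity y).fderiv

/-- `y ↦ DV(y)` is continuous for a `C²` profile. [cite: ConstantinIgnatovaVicol2026Putative, §3.4 eq. (3.19)] -/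
theorem continuous_fderiv_transport (h : IsSelfSimilarEulerProfile γ c U P) :
    Continuous fun y => fderiv ℝ (selfSimilarTransport γ c U) y := by
  have e : (fun y => fderiv ℝ (selfSimilarTransport γ c U) y) =
      fun y => γ • ContinuousLinearMap.id ℝ (EuclideanSpace ℝ (Fin 3)) + fderiv ℝ U y := funext (fderiv_transport_eq h)
  rw [e]
  exact continuous_const.add (h.contDiff_velocity.continuous_fderiv (by norm_num))

/-- `‖DV(y)‖ ≤ |γ| + K` when `‖DU‖ ≤ K`. [cite: ConstantinIgnatovaVicol2026Putative, §3.4 eq. (3.19)] -/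
theorem norm_fderiv_transport_le (h : IsSelfSimilarEulerProfile γ c U P) {K : ℝ}
    (hK : ∀ y, ‖fderiv ℝ U y‖ ≤ K) (y : (EuclideanSpace ℝ (Fin 3))) :
    ‖fderiv ℝ (selfSimilarTransport γ c U) y‖ ≤ |γ| + K := by
  rw [fderiv_transport_eq h]
  refine (norm_add_le _ _).trans (add_le_add ?_ (hK y))
  rw [norm_smul, Real.norm_eq_abs]
  exact mul_le_of_le_one_right (abs_nonneg γ) ContinuousLinearMap.norm_id_le

/-! ### Vorticity along trajectories: the quantitative Cauchy formula -/

/-- **`d/dt Ω(Y(t)) = σ (DV(Y) Ω(Y) − (1+γ) Ω(Y))` along `Y' = σ V(Y)`** (chain rule + the commutator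
identity `DΩ[V] − DV[Ω] = −(1+γ)Ω` of the vorticity equation (3.4)).
[cite: ConstantinIgnatovaVicol2026Putative, §3.4.1 eq. (3.22)] -/
theorem hasDerivAt_curl_comp (h : IsSelfSimilarEulerProfile γ c U P) {σ : ℝ} {Y : ℝ → (EuclideanSpace ℝ (Fin 3))} {t : ℝ}
    (hY : HasDerivAt Y (σ • selfSimilarTransport γ c U (Y t)) t) :
    HasDerivAt (fun s => curl U (Y s))
      (σ • (fderiv ℝ (selfSimilarTransport γ c U) (Y t) (curl U (Y t)) - (1 + γ) • curl U (Y t))) t := by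
  have hv := h.isSelfSimilarEulerVorticityProfile
  have hdc : DifferentiableAt ℝ (curl U) (Y t) := hv.differentiable_curl _
  have h1 : HasDerivAt (fun s => curl U (Y s))
      (fderiv ℝ (curl U) (Y t) (σ • selfSimilarTransport γ c U (Y t))) t :=
    hdc.hasFDerivAt.comp_hasDerivAt t hY
  refine h1.congr_deriv ?_
  rw [map_smul]
  congr 1
  have e := hv.fderiv_curl_transport_sub_fderiv_transport_curl (Y t)
  rw [sub_eq_iff_eq_add] at e
  rw [e]
  abel

/-- **The quantitative Cauchy formula as a linear ODE.** Along `Y' = σ V(Y)` the weighted vorticity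
`u(t) = e^{σ(1+γ)t} Ω(Y(t))` solves `u' = (σ DV(Y(t))) u`.  (For `σ = 1` this is CIV's (3.22)
`Ω(Y(a,τ)) = e^{−(1+γ)τ}∇_aY(a,τ)Ω(a)` differentiated in `τ`; no flow derivative is needed here.)
[cite: ConstantinIgnatovaVicol2026Putative, §3.4.1 eq. (3.22)] -/
theorem hasDerivAt_weightedCurl_comp (h : IsSelfSimilarEulerProfile γ c U P) {σ : ℝ} {Y : ℝ → (EuclideanSpace ℝ (Fin 3))}
    {t : ℝ} (hY : HasDerivAt Y (σ • selfSimilarTransport γ c U (Y t)) t) :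
    HasDerivAt (fun s => Real.exp (σ * (1 + γ) * s) • curl U (Y s))
      ((σ • fderiv ℝ (selfSimilarTransport γ c U) (Y t))
        (Real.exp (σ * (1 + γ) * t) • curl U (Y t))) t := by
  have h1 : HasDerivAt (fun s : ℝ => Real.exp (σ * (1 + γ) * s))
      (Real.exp (σ * (1 + γ) * t) * (σ * (1 + γ) * 1)) t :=
    ((hasDerivAt_id t).const_mul (σ * (1 + γ))).exp
  have h2 := hasDerivAt_curl_comp h hY
  have h := h1.smul h2
  refine h.congr_deriv ?_
  rw [FunLike.coe_smul, Pi.smul_apply, map_smul, smul_sub, smul_smul]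
  module

/-! ### The KILL step at a stagnation point with a lower growth certificate -/

/-- Perturbation of a two-sided quadratic estimate: if `‖R‖ ≤ δ` then
`|B(Rv, v) + B(v, Rv)| ≤ 2‖B‖δ‖v‖²`. [folklore] -/
private theorem bilin_perturb_le (B : (EuclideanSpace ℝ (Fin 3)) →L[ℝ] (EuclideanSpace ℝ (Fin 3)) →L[ℝ] ℝ) {R : (EuclideanSpace ℝ (Fin 3)) →L[ℝ] (EuclideanSpace ℝ (Fin 3))} {δ : ℝ}
    (hR : ‖R‖ ≤ δ) (v : (EuclideanSpace ℝ (Fin 3))) : |B (R v) v + B v (R v)| ≤ 2 * ‖B‖ * δ * ‖v‖ ^ 2 := by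
  have h1 : |B (R v) v| ≤ ‖B‖ * δ * ‖v‖ ^ 2 := by
    calc |B (R v) v| = ‖B (R v) v‖ := (Real.norm_eq_abs _).symm
      _ ≤ ‖B‖ * ‖R v‖ * ‖v‖ := B.le_opNorm₂ _ _
      _ ≤ ‖B‖ * (δ * ‖v‖) * ‖v‖ := by
          gcongr; exact (R.le_opNorm v).trans (mul_le_mul_of_nonneg_right hR (norm_nonneg _))
      _ = ‖B‖ * δ * ‖v‖ ^ 2 := by ring
  have h2 : |B v (R v)| ≤ ‖B‖ * δ * ‖v‖ ^ 2 := by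
    calc |B v (R v)| = ‖B v (R v)‖ := (Real.norm_eq_abs _).symm
      _ ≤ ‖B‖ * ‖v‖ * ‖R v‖ := B.le_opNorm₂ _ _
      _ ≤ ‖B‖ * ‖v‖ * (δ * ‖v‖) := by
          gcongr; exact (R.le_opNorm v).trans (mul_le_mul_of_nonneg_right hR (norm_nonneg _))
      _ = ‖B‖ * δ * ‖v‖ ^ 2 := by ring
  calc |B (R v) v + B v (R v)| ≤ |B (R v) v| + |B v (R v)| := abs_add_le _ _
    _ ≤ ‖B‖ * δ * ‖v‖ ^ 2 + ‖B‖ * δ * ‖v‖ ^ 2 := add_le_add h1 h2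
    _ = 2 * ‖B‖ * δ * ‖v‖ ^ 2 := by ring

/-- **THE KILL STEP: no vorticity is carried into a stagnation point whose velocity gradient admits a
lower growth certificate below the Cauchy rate `1 + γ`.**  Let `(U, P)` be a `C²` self-similar Euler
profile with bounded vorticity `‖curl U‖ ≤ m` and bounded gradient `‖DU‖ ≤ K`, and let `Y` be a
backward self-similar trajectory (`Y' = −V(Y)`, `V = γ(y−c) + U`) with `Y(t) → z` as `t → ∞`.  Suppose
`z` carries a coercive bilinear form `B` (`c_B‖v‖² ≤ B(v,v)`, `c_B > 0`) and `β' < 1 + γ` with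
`B(DV(z)v, v) + B(v, DV(z)v) ≤ 2β' B(v,v)` for all `v`.  Then `curl U (Y 0) = 0` (and, `0` being
arbitrary along the trajectory, the whole trajectory is irrotational).  Mechanism: the weighted
vorticity `u = e^{−(1+γ)t}Ω(Y)` solves `u' = −DV(Y)u` (`hasDerivAt_weightedCurl_comp`), is
`O(e^{−(1+γ)t})`, while near `z` the certificate gives `d/dt(e^{2(β'+ε)t}B(u,u)) ≥ 0`; so `u` vanishes
for large `t` (`eq_zero_of_norm_le_exp_of_lower_certificate`) and then at `t = 0` by uniqueness.
CIV prove the case "Ω ≡ 0 near every node" (Thm 3.10, via analyticity); the certificate exists iff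
every eigenvalue of `DU(z)` has real part `< 1`.
[cite: ConstantinIgnatovaVicol2026Putative, §3.4.1 eq. (3.22) and proof of Thm 3.10] -/
theorem curl_comp_eq_zero_of_tendsto_of_lowerCertificate (h : IsSelfSimilarEulerProfile γ c U P)
    {m : ℝ} (hm : ∀ y, ‖curl U y‖ ≤ m) {K : ℝ} (hK : ∀ y, ‖fderiv ℝ U y‖ ≤ K)
    {Y : ℝ → (EuclideanSpace ℝ (Fin 3))} (hY : ∀ t, HasDerivAt Y ((-1 : ℝ) • selfSimilarTransport γ c U (Y t)) t)
    {z : (EuclideanSpace ℝ (Fin 3))} (hz : Tendsto Y atTop (𝓝 z))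
    (B : (EuclideanSpace ℝ (Fin 3)) →L[ℝ] (EuclideanSpace ℝ (Fin 3)) →L[ℝ] ℝ) {cB : ℝ} (hcB : 0 < cB) (hB : ∀ v, cB * ‖v‖ ^ 2 ≤ B v v)
    {β' : ℝ} (hβ' : β' < 1 + γ)
    (hcert : ∀ v, B (fderiv ℝ (selfSimilarTransport γ c U) z v) v +
      B v (fderiv ℝ (selfSimilarTransport γ c U) z v) ≤ 2 * β' * B v v) :
    curl U (Y 0) = 0 := by
  set V := selfSimilarTransport γ c U with hVdef
  -- the linear equation `u' = A t (u t)`, `A t = -DV(Y t)`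
  set A : ℝ → (EuclideanSpace ℝ (Fin 3)) →L[ℝ] (EuclideanSpace ℝ (Fin 3)) := fun t => (-1 : ℝ) • fderiv ℝ V (Y t) with hA
  set u : ℝ → (EuclideanSpace ℝ (Fin 3)) := fun s => Real.exp ((-1 : ℝ) * (1 + γ) * s) • curl U (Y s) with hu
  have hu' : ∀ t, HasDerivAt u (A t (u t)) t := fun t => hasDerivAt_weightedCurl_comp h (hY t)
  -- decay of `u`
  have hdecay : ∀ t, ‖u t‖ ≤ m * Real.exp (-(1 + γ) * t) := by
    intro t
    simp only [hu, norm_smul, Real.norm_eq_abs, abs_of_pos (Real.exp_pos _)]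
    rw [mul_comm]
    have : Real.exp ((-1 : ℝ) * (1 + γ) * t) = Real.exp (-(1 + γ) * t) := by ring_nf
    rw [this]
    exact mul_le_mul_of_nonneg_right (hm _) (Real.exp_pos _).le
  -- choose `δ` and a time `t₀ ≥ 0` after which `‖DV(Y t) - DV z‖ ≤ δ`
  set δ : ℝ := cB * (1 + γ - β') / (2 * (‖B‖ + 1)) with hδ
  have hgap0 : 0 < 1 + γ - β' := by linarith
  have hδpos : 0 < δ := by positivity
  have hDV : Tendsto (fun t => fderiv ℝ V (Y t)) atTop (𝓝 (fderiv ℝ V z)) :=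
    ((continuous_fderiv_transport h).tendsto z).comp hz
  have hev : ∀ᶠ t in atTop, ‖fderiv ℝ V (Y t) - fderiv ℝ V z‖ ≤ δ := by
    have := (tendsto_iff_norm_sub_tendsto_zero.1 hDV)
    exact (this.eventually (ge_mem_nhds hδpos)).mono fun t ht => ht
  obtain ⟨t₁, ht₁⟩ := (hev.and (eventually_ge_atTop 0)).exists_forall_of_atTop
  -- wait: `exists_forall_of_atTop` gives `∃ a, ∀ b ≥ a, p b`
  set t₀ : ℝ := max t₁ 0 with ht₀
  have ht₀0 : 0 ≤ t₀ := le_max_right _ _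
  have hclose : ∀ t, t₀ ≤ t → ‖fderiv ℝ V (Y t) - fderiv ℝ V z‖ ≤ δ :=
    fun t ht => (ht₁ t ((le_max_left _ _).trans ht)).1
  -- the lower certificate along the trajectory for `t ≥ t₀`
  set μ : ℝ := -(β' + ‖B‖ * δ / cB) with hμ
  have hA : ∀ t, t₀ ≤ t → ∀ v, 2 * μ * B v v ≤ B (A t v) v + B v (A t v) := by
    intro t ht v
    set R : (EuclideanSpace ℝ (Fin 3)) →L[ℝ] (EuclideanSpace ℝ (Fin 3)) := fderiv ℝ V (Y t) - fderiv ℝ V z with hR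
    have hRδ : ‖R‖ ≤ δ := hclose t ht
    have hsplit : B (A t v) v + B v (A t v) =
        -(B (fderiv ℝ V z v) v + B v (fderiv ℝ V z v)) - (B (R v) v + B v (R v)) := by
      simp only [hA, hR, FunLike.coe_smul, Pi.smul_apply, FunLike.coe_sub,
        Pi.sub_apply, map_smul, map_sub, smul_eq_mul]
      ring
    have hpert := bilin_perturb_le B hRδ v
    have hvB : ‖v‖ ^ 2 ≤ B v v / cB := by
      rw [le_div_iff₀ hcB]; linarith [hB v]
    have h1 : B (R v) v + B v (R v) ≤ 2 * ‖B‖ * δ * ‖v‖ ^ 2 := (le_abs_self _).trans hpert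
    have h2 : 2 * ‖B‖ * δ * ‖v‖ ^ 2 ≤ 2 * ‖B‖ * δ * (B v v / cB) :=
      mul_le_mul_of_nonneg_left hvB (by positivity)
    have h3 := hcert v
    rw [hsplit]
    have : 2 * μ * B v v = -(2 * β' * B v v) - 2 * ‖B‖ * δ * (B v v / cB) := by
      simp only [hμ]; field_simp; ring
    rw [this]
    linarith
  -- the gap `λ + μ > 0` with `λ = 1 + γ`
  have hgap : 0 < (1 + γ) + μ := by
    have hB1 : ‖B‖ * δ / cB ≤ (1 + γ - β') / 2 := by
      rw [div_le_iff₀ hcB, hδ]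
      have hden : 0 < 2 * (‖B‖ + 1) := by positivity
      rw [show ‖B‖ * (cB * (1 + γ - β') / (2 * (‖B‖ + 1))) =
        (‖B‖ / (‖B‖ + 1)) * ((1 + γ - β') / 2 * cB) by field_simp]
      have hfrac : ‖B‖ / (‖B‖ + 1) ≤ 1 := by
        rw [div_le_one (by positivity)]; linarith
      have hpos : 0 ≤ (1 + γ - β') / 2 * cB := by positivity
      calc ‖B‖ / (‖B‖ + 1) * ((1 + γ - β') / 2 * cB) ≤ 1 * ((1 + γ - β') / 2 * cB) :=
            mul_le_mul_of_nonneg_right hfrac hpos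
        _ = (1 + γ - β') / 2 * cB := one_mul _
    simp only [hμ]
    linarith
  -- KILL: `u t₀ = 0`
  have hut₀ : u t₀ = 0 :=
    eq_zero_of_norm_le_exp_of_lower_certificate B hcB hB (fun t _ => hu' t) hA
      (fun t _ => hdecay t) hgap
  -- transport back to `t = 0` by uniqueness for the linear equation on `[0, t₀]`
  have hKV : ∀ t, LipschitzOnWith (Real.toNNReal (|γ| + K)) (fun x : (EuclideanSpace ℝ (Fin 3)) => A t x) univ := by
    intro t
    refine ((A t).lipschitz.weaken ?_).lipschitzOnWith
    rw [← NNReal.coe_le_coe, coe_nnnorm,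
      Real.coe_toNNReal _ (add_nonneg (abs_nonneg γ) ((norm_nonneg _).trans (hK 0)))]
    calc ‖A t‖ = ‖fderiv ℝ V (Y t)‖ := by
          show ‖(-1 : ℝ) • fderiv ℝ V (Y t)‖ = _
          rw [norm_smul, norm_neg, norm_one, one_mul]
      _ ≤ |γ| + K := norm_fderiv_transport_le h hK (Y t)
  have hcont : ContinuousOn u (Icc 0 t₀) := fun t _ => (hu' t).continuousAt.continuousWithinAt
  have hEq : EqOn u (fun _ => (0 : (EuclideanSpace ℝ (Fin 3)))) (Icc 0 t₀) :=
    ODE_solution_unique_of_mem_Icc_left (v := fun t x => A t x) (s := fun _ => univ)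
      (fun t _ => hKV t) hcont (fun t _ => (hu' t).hasDerivWithinAt) (fun _ _ => mem_univ _)
      continuousOn_const
      (fun t _ => by
        have h0 : HasDerivWithinAt (fun _ : ℝ => (0 : (EuclideanSpace ℝ (Fin 3)))) 0 (Iic t) t := hasDerivWithinAt_const _ _ _
        simpa using h0)
      (fun _ _ => mem_univ _) (by simpa using hut₀)
  have hu0 : u 0 = 0 := hEq ⟨le_rfl, ht₀0⟩
  simpa [hu] using hu0

end Summit.NavierStokesRegularity.NavierStokesRegularity.Theorems.PowerGaugeEulerLiouville.NodalFiniteness
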